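import Literature.NumberTheory.EllipticCurves.TunnellThmTwoChi2Proofs
import Literature.NumberTheory.EllipticCurves.TunnellWeightThreeHalvesBasisProofs
import HarnessLib

/-!
# Tunnell 1983, Theorem 2 for the trivial character: `g θ₂, g θ₈ ∈ S_{3/2}(128, 1, φ)` — PROVED

Discharge of the named fact `Tunnell1983_thm2_triv` of `TunnellHalfIntegralForms`
(`Tunnell1983_thm2_triv_holds`): Tunnell's forms `g θ₂` and `g θ₈` are cusp forms of weight
`3/2`, level `128` and trivial character which are `T(p²)`-eigenforms with the eigenvalues
`a_p(E)` of the newform `φ` of level `32` (`E : y² = x³ - x`) for every odd prime `p`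
(`heckeTSq_tunnellForm_two`, and `TunnellThmTwoOrdinaryProofs.heckeTSq_tunnellForm_eight`), hence
lie in the Shimura–Waldspurger space `S_{3/2}(128, 1, φ)`.

## Proof

Tunnell (pp. 327–328) shows that `g θ₈` and `g(θ₂ - θ₈)` are eigenforms of every `T(p²)` (this is
a theorem of the tree: `heckeTSq_tunnellForm_eight_eigen`, `heckeTSq_two_sub_eight_eigen` of
`TunnellWeightThreeHalvesBasisProofs`, unconditional since the spanning statement (CO) is proved
there) and identifies the eigenvalues with `a_p(E)` through Shimura's correspondence [18] and
Niwa [11]. Here instead: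

* the eigenvalue of `g θ₈` is `a_p(E)` by `TunnellThmTwoOrdinaryProofs.heckeTSq_tunnellForm_eight`
  (Jacobi's `θ₁' = θ₂θ₃θ₄` and the arithmetic of `ℤ[i]`);
* the eigenvalue `λ_p` of `g(θ₂ - θ₈)` is carried along the Fricke involution
  `(W f)(z) = (-iz)^{-3/2} f(-1/(128 z))`: `W(g(θ₂ - θ₈)) = 32 (2 g θ₁₆ - g θ₄)`
  (`TunnellFormsFrickeProofs.tunnellForm_two_sub_eight_fricke`), and `W` intertwines `T(p²)` on
  `M_{3/2}(128, 1)` with `T(p²)` on `M_{3/2}(128, χ₂)`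
  (`HalfIntegralWeightFrickeHeckeProofs.heckeTSq_eq_smul_of_frickeFun`, Shimura 1973, Prop. 1.5),
  so `2 g θ₁₆ - g θ₄` is a `T(p²)`-eigenform with eigenvalue `λ_p`; but `g θ₄` and `g θ₁₆` have the
  eigenvalue `a_p(E)` (`TunnellThmTwoChi2Proofs.heckeTSq_tunnellForm_four/sixteen`, Theorem 2 for
  `χ₂`), and `2 g θ₁₆ - g θ₄ ≠ 0` (coefficient `1` at `q¹`), whence `λ_p = a_p(E)`;
* `g θ₂ = g(θ₂ - θ₈) + g θ₈`.

No definitions, no named facts.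

## References

* J. B. Tunnell, *A classical Diophantine problem and modular forms of weight 3/2*, Invent. Math.
  72 (1983) 323–334, Thm. 2 and its proof, pp. 327–328. [Tunnell1983Congruent]
* G. Shimura, *On modular forms of half integral weight*, Ann. of Math. 97 (1973) 440–481, §1,
  Prop. 1.5, Thm. 1.7. [Shimura1973HalfIntegral]
-/

noncomputable section

open UpperHalfPlane hiding I
open Complex
open scoped NumberTheorySymbols

namespace Literature.NumberTheory.EllipticCurves.Tunnell1983

open Literature.NumberTheory.EllipticCurves.ModularForms

/-! ### `W(g(θ₂ - θ₈)) = 32 (2 g θ₁₆ - g θ₄)` -/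

/-- **`W(g(θ₂ - θ₈)) = 32 (2 g θ₁₆ - g θ₄)`** for `(W f)(z) = √(-iz)⁻³ f(-1/(128 z))`
(`frickeFun 128 3`). [cite: Tunnell1983Congruent, p. 327] -/
theorem frickeFun_tunnellForm_two_sub_eight (z : ℍ) :
    frickeFun 128 3 (tunnellForm 2 - tunnellForm 8) z =
      32 * ((2 : ℂ) • tunnellForm 16 - tunnellForm 4) z := by
  have h0 := csqrt_neg_I_mul_ne_zero z
  unfold frickeFun
  rw [frickePoint_eq_frickePt, Pi.sub_apply, tunnellForm_two_sub_eight_fricke, frickeR_eq_csqrt]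
  simp only [Pi.sub_apply, Pi.smul_apply, smul_eq_mul]
  calc _ = 32 * (2 * tunnellForm 16 z - tunnellForm 4 z) *
        ((Complex.sqrt (-I * (z : ℂ)))⁻¹ * Complex.sqrt (-I * (z : ℂ))) ^ 3 := by ring
    _ = _ := by rw [inv_mul_cancel₀ h0, one_pow, mul_one]

/-! ### The eigenvalues of `2 g θ₁₆ - g θ₄`, of `g(θ₂ - θ₈)` and of `g θ₂` -/

/-- `2 g θ₁₆ - g θ₄ ∈ M_{3/2}(128, χ₂)`. [folklore] -/
theorem two_smul_sixteen_sub_four_mem :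
    (2 : ℂ) • tunnellForm 16 - tunnellForm 4 ∈ halfIntModularForms 3 128 tunnellChar :=
  sub_mem (Submodule.smul_mem _ _ (halfIntCuspForms_le_halfIntModularForms _ _ _
    tunnellForm_sixteen_mem_halfIntCuspForms))
    (halfIntCuspForms_le_halfIntModularForms _ _ _ tunnellForm_four_mem_halfIntCuspForms)

/-- `qCoeffs (2 g θ₁₆ - g θ₄) = 2 qCoeffs (g θ₁₆) - qCoeffs (g θ₄)`. [folklore] -/
theorem qCoeffs_two_smul_sixteen_sub_four :
    qCoeffs ((2 : ℂ) • tunnellForm 16 - tunnellForm 4) =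
      (2 : ℂ) • qCoeffs (tunnellForm 16) - qCoeffs (tunnellForm 4) := by
  have hM4 := halfIntCuspForms_le_halfIntModularForms _ _ _ tunnellForm_four_mem_halfIntCuspForms
  have hM16 := halfIntCuspForms_le_halfIntModularForms _ _ _ tunnellForm_sixteen_mem_halfIntCuspForms
  rw [show (2 : ℂ) • tunnellForm 16 - tunnellForm 4 =
      (2 : ℂ) • tunnellForm 16 - (1 : ℂ) • tunnellForm 4 by rw [one_smul],
    qCoeffs_sub_smul (Submodule.smul_mem _ _ hM16) hM4, qCoeffs_smul hM16, one_smul]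

/-- **`T(p²)(2 g θ₁₆ - g θ₄) = a_p(E) (2 g θ₁₆ - g θ₄)`** for every odd prime `p` (Theorem 2 for
`χ₂`: both `g θ₄` and `g θ₁₆` have the eigenvalue `a_p(E)`).
[cite: Tunnell1983Congruent, Thm 2 and its proof, pp. 327–328] -/
theorem heckeTSq_two_smul_sixteen_sub_four {p : ℕ} (hp : p.Prime) (hp2 : p ≠ 2) :
    heckeTSq 3 tunnellChar p (qCoeffs ((2 : ℂ) • tunnellForm 16 - tunnellForm 4)) =
      tunnellEigenvalues p • qCoeffs ((2 : ℂ) • tunnellForm 16 - tunnellForm 4) := by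
  rw [qCoeffs_two_smul_sixteen_sub_four, map_sub, map_smul, heckeTSq_tunnellForm_four hp hp2,
    heckeTSq_tunnellForm_sixteen hp hp2, smul_sub, smul_comm]

/-- **`T(p²)(g(θ₂ - θ₈)) = a_p(E) · g(θ₂ - θ₈)` for every odd prime `p`**: the eigenvalue `λ_p`
of the eigenform `g(θ₂ - θ₈)` is transferred along the Fricke involution to `2 g θ₁₆ - g θ₄`,
which has the eigenvalue `a_p(E)` and is non-zero.
[cite: Tunnell1983Congruent, Thm 2 and its proof, pp. 327–328] -/
theorem heckeTSq_tunnellForm_two_sub_eight {p : ℕ} (hp : p.Prime) (hp2 : p ≠ 2) :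
    heckeTSq 3 (1 : DirichletCharacter ℂ 128) p (qCoeffs (tunnellForm 2 - tunnellForm 8)) =
      tunnellEigenvalues p • qCoeffs (tunnellForm 2 - tunnellForm 8) := by
  haveI : Fact p.Prime := ⟨hp⟩
  have hpN := not_dvd_of_odd_prime hp hp2
  have hev := heckeTSq_two_sub_eight_eigen hp hp2
  set ev := heckeTSq 3 (1 : DirichletCharacter ℂ 128) p
    (qCoeffs (tunnellForm 2 - tunnellForm 8)) 3 / 2 with hevdef
  have hM2 := halfIntCuspForms_le_halfIntModularForms _ _ _ tunnellForm_two_mem_halfIntCuspForms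
  have hM8 := halfIntCuspForms_le_halfIntModularForms _ _ _ tunnellForm_eight_mem_halfIntCuspForms
  -- transfer of `ev` along `W`
  have h := heckeTSq_eq_smul_of_frickeFun (N := 128) (k := 3)
    (χ := (1 : DirichletCharacter ℂ 128)) (χ' := tunnellChar) (p := p)
    ⟨16, by norm_num⟩ hpN ⟨1, by norm_num⟩ (sub_mem hM2 hM8) two_smul_sixteen_sub_four_mem
    (tunnellChar_eq_one_inv_mul_jacobi hp hp2) (c := 32) (by norm_num)
    frickeFun_tunnellForm_two_sub_eight hev
  have hu : IsUnit (p : ZMod 128) := (ZMod.isUnit_prime_iff_not_dvd hp).mpr hpN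
  rw [MulChar.one_apply hu, inv_one, one_pow, one_mul] at h
  -- compare with the eigenvalue `a_p(E)` at the coefficient of `q¹`
  have v4 : qCoeffs (tunnellForm 4) 1 = 1 := qCoeffs_tunnellForm_values.2.2.2.2.1.1
  have v16 : qCoeffs (tunnellForm 16) 1 = 1 := qCoeffs_tunnellForm_values.2.2.2.2.2.1
  have hv1 : qCoeffs ((2 : ℂ) • tunnellForm 16 - tunnellForm 4) 1 = 1 := by
    rw [qCoeffs_two_smul_sixteen_sub_four, Pi.sub_apply, Pi.smul_apply, smul_eq_mul, v4, v16]
    norm_num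
  have key : ev = tunnellEigenvalues p := by
    have e1 := congrFun h 1
    have e2 := congrFun (heckeTSq_two_smul_sixteen_sub_four hp hp2) 1
    rw [e1, Pi.smul_apply, Pi.smul_apply, smul_eq_mul, smul_eq_mul, hv1, mul_one, mul_one] at e2
    exact e2
  rw [hev, key]

/-- **`T(p²)(g θ₂) = a_p(E) · g θ₂` for every odd prime `p`**: `g θ₂ = g(θ₂ - θ₈) + g θ₈`.
[cite: Tunnell1983Congruent, Thm 2, p. 327] -/
theorem heckeTSq_tunnellForm_two {p : ℕ} (hp : p.Prime) (hp2 : p ≠ 2) :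
    heckeTSq 3 (1 : DirichletCharacter ℂ 128) p (qCoeffs (tunnellForm 2)) =
      tunnellEigenvalues p • qCoeffs (tunnellForm 2) := by
  have hM2 := halfIntCuspForms_le_halfIntModularForms _ _ _ tunnellForm_two_mem_halfIntCuspForms
  have hM8 := halfIntCuspForms_le_halfIntModularForms _ _ _ tunnellForm_eight_mem_halfIntCuspForms
  have hsplit : qCoeffs (tunnellForm 2) =
      qCoeffs (tunnellForm 2 - tunnellForm 8) + qCoeffs (tunnellForm 8) := by
    rw [← qCoeffs_add (sub_mem hM2 hM8) hM8, sub_add_cancel]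
  rw [hsplit, map_add, heckeTSq_tunnellForm_two_sub_eight hp hp2, heckeTSq_tunnellForm_eight hp hp2,
    smul_add]

/-! ### Theorem 2 (trivial character) -/

/-- **Tunnell 1983, Theorem 2 for the trivial character** (the named fact `Tunnell1983_thm2_triv`,
DISCHARGED): `g θ₂` and `g θ₈` lie in `S_{3/2}(128, 1, φ)`, i.e. they are cusp forms of weight
`3/2`, level `128`, trivial character (`TunnellFormsCuspidalProofs`) which are `T(p²)`-eigenforms
with the eigenvalues `a_p(E)` for all primes `p ∤ 128`. [cite: Tunnell1983Congruent, Thm 2 (p. 327)] -/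
theorem Tunnell1983_thm2_triv_holds : Tunnell1983_thm2_triv := by
  have hne : ∀ p : ℕ, p.Prime → ¬ p ∣ 128 → p ≠ 2 := by
    rintro p - hpN rfl
    exact hpN ⟨64, by norm_num⟩
  exact ⟨mem_shimuraSubspace_of_isAlmostEigenform tunnellForm_two_mem_halfIntCuspForms
      (isAlmostEigenform_of_forall fun p hp hpN ↦ heckeTSq_tunnellForm_two hp (hne p hp hpN)),
    mem_shimuraSubspace_of_isAlmostEigenform tunnellForm_eight_mem_halfIntCuspForms
      (isAlmostEigenform_of_forall fun p hp hpN ↦ heckeTSq_tunnellForm_eight hp (hne p hp hpN))⟩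

end Literature.NumberTheory.EllipticCurves.Tunnell1983
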